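import Literature.Barriers.CriticalPhenomena.PlaquetteWalkHoleRootLawLWalls
import Literature.Barriers.CriticalPhenomena.PlaquetteWalkHoleRootWallAdjacent
import HarnessLib

/-!
# Barrier catalogue (SAWScalingLimit): THE DOOR BELOW THE ROOT EDGE, and the THIN BOX OF HEIGHT FOUR — whole-range
vanishings and isolated endpoint zeros next to a hole one row off the wall

Assembly leaf (no new mechanism, no new definition) of `PlaquetteWalkHoleRootLawLWalls` (the wall files:
`…HoleColumn` / `…PrefixWall` — the door `holeS | rootS`; `…ShutRow` / `…ShutRowEast` — shut rows; `…ThinSide` — a hole one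
row off the wall empties the under route and `Im VF > 0` on the whole range; `…LawLBoxes` / `…Corridor` / `…WestCorridor` —
the corner corridor kills) and `PlaquetteWalkHoleRootWallAdjacent` (box plumbing). Setting: face lists `Dl`, a root plaquette
`w` rooted at its `W` side, hole `(w.1 − 1, w.2)` absent, far cell `farW w = (w.1 − 2, w.2)`; the Yang–Baxter vertex functional
`VF(θ)` with the printed weights at the far cell, `θ ∈ [π/3, 2π/3]`; boxes `boxMinus m n S` with hole `h`, `w = (h.1 + 1, h.2)`.

* §1 (every domain): an interior mid-edge of a walk has both rhombi in the domain (`YBWalk.door_nth` of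
  `PlaquetteWalkHoleRootConfinement`). With `PlaquetteWalkHoleRootHoleColumn` (column strictly below `holeS = (w.1 − 1, w.2 − 1)` shut ⇒ a WOUND walk's excursion
  takes the door `holeS | rootS`): ★★★★ `ΩG.WE_eq_excursionWinding_of_holeColumn_door` — if moreover `holeS` or
  `rootS = (w.1, w.2 − 1)` is ABSENT, no class-`B2a` walk at the far cell is wound (either route); `VF ≡ 0`
  (`vertexFunctional_printed_eq_zero_of_holeColumn_door`).
* §2 (all boxes, any further defects `S ∋ h` missing the far cell): `lawL_box_farSW_eq_zero`, `lawL_box_farNW_eq_zero` (the far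
  cell's inner doors: `VF ≡ 0`), ★★★★ `lawL_box_holeColumn_door_eq_zero` (the column below the hole removed down to the wall
  together with `holeS` or `rootS` ⇒ `VF ≡ 0`); THIN BOX (`h.2 = 1`): `thinBox_holeS_vertexFunctional_eq_zero` (the cell below the
  hole removed ⇒ `VF ≡ 0`), `thinBox_rootS_vertexFunctional_eq_zero` (the cell below the root plaquette ⇒ `VF ≡ 0`).
* §3–§4 thin-side tools with ABSTRACT over witnesses: `im_vertexFunctional_printed_pos_of_thinS_of_witnesses` (a `w₂`-free and a
  `w₁`-free wound over-walk at every angle ⇒ `Im VF > 0` on the closed range), `…_of_w2free` (⇒ on `[π/3, 2π/3)`), `…_of_w1free`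
  (⇒ on `(π/3, 2π/3]`); `vertexFunctional_printed_eq_zero_of_thinS_of_over_empty` (both routes empty ⇒ `VF ≡ 0`),
  `…two_pi_div_three_eq_zero_of_thinS_of_over_w1_killed`, `…pi_div_three_eq_zero_of_thinS_of_over_w2_killed`.
* §5 ★★★★★ THE THIN BOX OF HEIGHT FOUR (`m × 4`, hole `(h.1, 1)`, `2 ≤ h.1 ≤ m − 3`; the top wall two rows above the hole), one
  top-row cell removed: `K_N1 = (h.1 − 2, 3)` ⇒ `VF(2π/3) = 0` EXACTLY and `Im VF(θ) > 0` on `[π/3, 2π/3)`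
  (`thinBox4_killNW_vertexFunctional_two_pi_div_three_eq_zero`, `thinBox4_killNW_im_pos_of_lt`) — an ISOLATED ENDPOINT ZERO (both
  routes dead at the dual angle only); `K_N2 = (h.1 + 2, 3)` ⇒ `VF(π/3) = 0` exactly, `Im VF > 0` on `(π/3, 2π/3]`; the cell above
  `farNW` or above the hole ⇒ `VF ≡ 0` (both routes empty: `thinBox4_farNWN_…`, `thinBox4_holeNN_…`); the cell above `rootN` ⇒
  `VF(π/3) = 0` (`thinBox4_rootNN_…`). Compare `PlaquetteWalkHoleRootThinSide`: the plain thin box has NO zero on the range, and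
  the height-three strip vanishes identically.

What is NOT here (successor, kit j291139–43 of the lane): the interior thin box's near cells that keep `VF ≠ 0` (new over
witnesses avoiding `holeN`, `rootN`, `pocketNE`, … — definitions, a separate leaf).

Not in print; venture lane «pcv-sawmu», seat b-step0 gen 27.

References: A. Glazman, I. Manolescu, arXiv:1708.00395v3, §1 (Fig. 1, Fig. 2, the remark after eq. (1)), §2.1, §4.2 and
Lemma 2.1 [GlazmanManolescu2019]; A. Glazman, Electron. Commun. Probab. 20 (2015) no. 86, Lemma 3.1, proof pp. 6–7
[Glazman2015WeightedSAW]; R. Courant, H. Robbins, *What is Mathematics?* (1941/1958), Ch. V Appendix §2 (the even–odd rule)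
[CourantRobbins1958].
-/

noncomputable section

open Set Function Complex

namespace Literature.Probability.RandomPlanarGeometry.SAW.YangBaxter

open Real

/-! ## §1 The door below the root edge -/


namespace ΩG

variable {D : Set Face} {w : Face}

/-- The two rhombi of the door `holeS | rootS`. [cite: GlazmanManolescu2019, §1 (the lattice of rhombi and its mid-edges)] -/
theorem rootS_side_W_faces (w : Face) : ((rootS w).side .W).faces = (((w.1 - 1, w.2 - 1) : Face), rootS w) := by
  rw [rootS_side_W_eq]
  obtain ⟨a, b⟩ := w
  simp [rootS, MidEdge.faces]

/-- ★★★ **A wound walk needs BOTH rhombi of the door `holeS | rootS`** (column strictly below `holeS` shut): its excursion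
takes that door, an interior mid-edge. [cite: GlazmanManolescu2019, §1, Lemma 2.1] [cite: CourantRobbins1958, Ch. V Appendix §2 (the even–odd rule)] -/
theorem holeS_mem_rootS_mem_of_wound_holeColumn (hcol : ∀ y : ℤ, y ≤ w.2 - 2 → ((w.1 - 1, y) : Face) ∉ D)
    (ω : ΩG D (w.side .W) (farW w)) (hr : RootedFace D (w.side .W) (farW w)) (h : ω.IsB2a) {θ : ℝ}
    (hW : ω.WE (fun _ => θ) ≠ excursionWinding θ ω.2.firstSideG (ω.z1 hr h) ω.1) :
    ((w.1 - 1, w.2 - 1) : Face) ∈ D ∧ rootS w ∈ D := by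
  obtain ⟨k, hk1, hk2, e⟩ := exists_excursion_nth_eq_rootS_W_of_wound_holeColumn hcol ω hr h hW
  have hB2 : ω.2.firstHitG + 1 < ω.2.arcs.length := h.1
  have hf := ω.2.door_nth (j := k) (by omega) (by omega)
  rw [e, rootS_side_W_faces] at hf
  exact hf

/-- ★★★★ **DOOR BELOW THE ROOT EDGE SHUT ⇒ NO WOUND WALK.** If the column strictly below `holeS` is shut and `holeS` or
`rootS` itself is absent, every class-`B2a` walk at the far cell — under or over — is unwound.
[cite: GlazmanManolescu2019, Lemma 2.1 (statement, "in the form given in [Gl]")] [cite: Glazman2015WeightedSAW, Lemma 3.1 (proof, pp. 6–7)]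
[cite: CourantRobbins1958, Ch. V Appendix §2 (the even–odd rule)] -/
theorem WE_eq_excursionWinding_of_holeColumn_door (hcol : ∀ y : ℤ, y ≤ w.2 - 2 → ((w.1 - 1, y) : Face) ∉ D)
    (hdoor : ((w.1 - 1, w.2 - 1) : Face) ∉ D ∨ rootS w ∉ D)
    (ω : ΩG D (w.side .W) (farW w)) (hr : RootedFace D (w.side .W) (farW w)) (h : ω.IsB2a) (θ : ℝ) :
    ω.WE (fun _ => θ) = excursionWinding θ ω.2.firstSideG (ω.z1 hr h) ω.1 := by
  by_contra hW
  obtain ⟨h1, h2⟩ := holeS_mem_rootS_mem_of_wound_holeColumn hcol ω hr h hW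
  rcases hdoor with hd | hd
  · exact hd h1
  · exact hd h2

/-- Both route masses vanish identically. [cite: GlazmanManolescu2019, Lemma 2.1 (statement, "in the form given in [Gl]")] -/
theorem sum_routeMassW_eq_zero_of_holeColumn_door [Finite D] (hcol : ∀ y : ℤ, y ≤ w.2 - 2 → ((w.1 - 1, y) : Face) ∉ D)
    (hdoor : ((w.1 - 1, w.2 - 1) : Face) ∉ D ∨ rootS w ∉ D)
    (hr : RootedFace D (w.side .W) (farW w)) (s : Side) (θ : ℝ) :
    ∑ ω ∈ setB2a D (w.side .W) (farW w), routeMassW θ hr s ω = 0 := by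
  classical
  refine Finset.sum_eq_zero fun ω _ => ?_
  unfold routeMassW
  split_ifs with h1 h2
  · exact absurd (WE_eq_excursionWinding_of_holeColumn_door hcol hdoor ω hr h1 θ) h2.2
  · rfl
  · rfl

end ΩG

end Literature.Probability.RandomPlanarGeometry.SAW.YangBaxter

namespace Literature.Barriers.CriticalPhenomena.PlaquetteWalk

open Literature.Probability.RandomPlanarGeometry.SAW.YangBaxter
open Real Complex

section DoorVF

variable {Dl : List Face} {w : Face}

/-- ★★★★ **DOOR BELOW THE ROOT EDGE SHUT ⇒ `VF ≡ 0`.** Column strictly below `holeS` shut and `holeS` or `rootS` absent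
(far cell present, hole absent) ⇒ the vertex functional with the printed weights vanishes at the far cell for every
`θ ∈ [π/3, 2π/3]`. [cite: GlazmanManolescu2019, Lemma 2.1 (statement, "in the form given in [Gl]")] [cite: Glazman2015WeightedSAW, Lemma 3.1 (proof, pp. 6–7)] -/
theorem vertexFunctional_printed_eq_zero_of_holeColumn_door {θ : ℝ} (hθ : θ ∈ Set.Icc (π / 3) (2 * π / 3))
    (hf : farW w ∈ Dl) (hh : holeFaceW w ∉ dom Dl)
    (hcol : ∀ y : ℤ, y ≤ w.2 - 2 → ((w.1 - 1, y) : Face) ∉ dom Dl)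
    (hdoor : ((w.1 - 1, w.2 - 1) : Face) ∉ dom Dl ∨ rootS w ∉ dom Dl) :
    vertexFunctional (printedWeights θ) tFiveEighths (ybCoeff θ) Dl (w.side .W) (farW w) = 0 := by
  have hr : RootedFace (dom Dl) (w.side .W) (farW w) := ⟨hf, fun hb => hh (by rw [root_faces_W] at hb; exact hb.1)⟩
  rw [vertexFunctional_printed_farCellW_eq hθ Dl w hf hh hr,
    ΩG.sum_routeMassW_eq_zero_of_holeColumn_door hcol hdoor hr .S θ,
    ΩG.sum_routeMassW_eq_zero_of_holeColumn_door hcol hdoor hr .N θ]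
  simp

end DoorVF


/-! ## §2 All boxes: the inner doors of the far cell and the door below the root edge -/

section BoxDoors

variable {m n : ℕ} {S : List Face} {h : Face}

/-- ★★★ **ALL BOXES: removing `farSW = (h.1 − 1, h.2 − 1)` (the far cell's southern neighbour) closes a door ⇒ `VF ≡ 0`**
on `[π/3, 2π/3]`, whatever else is removed (`S ∋ h`, far cell kept). [cite: GlazmanManolescu2019, Lemma 2.1 (proof: [Gl])]
[cite: Glazman2015WeightedSAW, Lemma 3.1 (proof, pp. 6–7)] -/
theorem lawL_box_farSW_eq_zero (hW : 1 ≤ h.1) (hE : h.1 + 2 ≤ m) (hS : 0 ≤ h.2) (hN : h.2 + 1 ≤ n) (hh : h ∈ S)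
    (hfS : ((h.1 - 1, h.2) : Face) ∉ S) (hc : ((h.1 - 1, h.2 - 1) : Face) ∈ S) {θ : ℝ}
    (hθ : θ ∈ Set.Icc (π / 3) (2 * π / 3)) :
    vertexFunctional (printedWeights θ) tFiveEighths (ybCoeff θ) (boxMinus m n S) (Face.side (h.1 + 1, h.2) .W)
      (farW (h.1 + 1, h.2)) = 0 := by
  have hf := farW_hroot_mem_boxMinus_of_not_mem (m := m) (n := n) hW (by omega) hS hN hfS
  have hhD : holeFaceW ((h.1 + 1, h.2) : Face) ∉ dom (boxMinus m n S) := by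
    rw [holeFaceW_hroot]; exact not_mem_dom_boxMinus_of_mem hh
  refine vertexFunctional_printed_farCellW_eq_zero_of_door_closed hθ _ _ hf hhD (Or.inr (Or.inl ?_))
    (rootedFace_hroot_boxMinus_of_mem hf hh)
  have e : farSW ((h.1 + 1, h.2) : Face) = (h.1 - 1, h.2 - 1) := Prod.ext (by simp only [farSW]; omega) rfl
  rw [e]; exact not_mem_dom_boxMinus_of_mem hc

/-- ★★★ **ALL BOXES: removing `farNW = (h.1 − 1, h.2 + 1)` closes a door ⇒ `VF ≡ 0`.**
[cite: GlazmanManolescu2019, Lemma 2.1 (proof: [Gl])] [cite: Glazman2015WeightedSAW, Lemma 3.1 (proof, pp. 6–7)] -/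
theorem lawL_box_farNW_eq_zero (hW : 1 ≤ h.1) (hE : h.1 + 2 ≤ m) (hS : 0 ≤ h.2) (hN : h.2 + 1 ≤ n) (hh : h ∈ S)
    (hfS : ((h.1 - 1, h.2) : Face) ∉ S) (hc : ((h.1 - 1, h.2 + 1) : Face) ∈ S) {θ : ℝ}
    (hθ : θ ∈ Set.Icc (π / 3) (2 * π / 3)) :
    vertexFunctional (printedWeights θ) tFiveEighths (ybCoeff θ) (boxMinus m n S) (Face.side (h.1 + 1, h.2) .W)
      (farW (h.1 + 1, h.2)) = 0 := by
  have hf := farW_hroot_mem_boxMinus_of_not_mem (m := m) (n := n) hW (by omega) hS hN hfS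
  have hhD : holeFaceW ((h.1 + 1, h.2) : Face) ∉ dom (boxMinus m n S) := by
    rw [holeFaceW_hroot]; exact not_mem_dom_boxMinus_of_mem hh
  refine vertexFunctional_printed_farCellW_eq_zero_of_door_closed hθ _ _ hf hhD (Or.inl ?_)
    (rootedFace_hroot_boxMinus_of_mem hf hh)
  have e : farNW ((h.1 + 1, h.2) : Face) = (h.1 - 1, h.2 + 1) := Prod.ext (by simp only [farNW]; omega) rfl
  rw [e]; exact not_mem_dom_boxMinus_of_mem hc

/-- ★★★★ **ALL BOXES: the column below the hole shut down to the wall and the door `holeS | rootS` broken ⇒ `VF ≡ 0`.**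
If `S ∋ h` misses the far cell, contains every cell `(h.1, y)` with `0 ≤ y ≤ h.2 − 2` (the column strictly below
`holeS = (h.1, h.2 − 1)`) and contains `holeS` or `rootS = (h.1 + 1, h.2 − 1)`, then no walk at the far cell is wound and
the vertex functional vanishes on `[π/3, 2π/3]`. [cite: GlazmanManolescu2019, Lemma 2.1 (statement, "in the form given in [Gl]")]
[cite: Glazman2015WeightedSAW, Lemma 3.1 (proof, pp. 6–7)] [cite: CourantRobbins1958, Ch. V Appendix §2 (the even–odd rule)] -/
theorem lawL_box_holeColumn_door_eq_zero (hW : 1 ≤ h.1) (hE : h.1 + 2 ≤ m) (hS : 0 ≤ h.2) (hN : h.2 + 1 ≤ n) (hh : h ∈ S)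
    (hfS : ((h.1 - 1, h.2) : Face) ∉ S) (hcolS : ∀ y : ℤ, 0 ≤ y → y ≤ h.2 - 2 → ((h.1, y) : Face) ∈ S)
    (hdoor : ((h.1, h.2 - 1) : Face) ∈ S ∨ ((h.1 + 1, h.2 - 1) : Face) ∈ S) {θ : ℝ}
    (hθ : θ ∈ Set.Icc (π / 3) (2 * π / 3)) :
    vertexFunctional (printedWeights θ) tFiveEighths (ybCoeff θ) (boxMinus m n S) (Face.side (h.1 + 1, h.2) .W)
      (farW (h.1 + 1, h.2)) = 0 := by
  have hf := farW_hroot_mem_boxMinus_of_not_mem (m := m) (n := n) hW (by omega) hS hN hfS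
  refine vertexFunctional_printed_eq_zero_of_holeColumn_door hθ hf ?_ (fun y hy hm => ?_) ?_
  · rw [holeFaceW_hroot]; exact not_mem_dom_boxMinus_of_mem hh
  · obtain ⟨hb, hs⟩ := mem_dom_boxMinus.1 hm
    simp only at hb hy
    have e : (((h.1 + 1, h.2) : Face).1 - 1, y) = ((h.1, y) : Face) := Prod.ext (by simp only; omega) rfl
    rw [e] at hs
    exact hs (hcolS y (by omega) (by omega))
  · rcases hdoor with hd | hd
    · left
      have e : ((((h.1 + 1, h.2) : Face).1 - 1, ((h.1 + 1, h.2) : Face).2 - 1) : Face) = (h.1, h.2 - 1) :=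
        Prod.ext (by simp only; omega) rfl
      rw [e]; exact not_mem_dom_boxMinus_of_mem hd
    · right
      have e : rootS ((h.1 + 1, h.2) : Face) = (h.1 + 1, h.2 - 1) := Prod.ext (by simp only [rootS]) rfl
      rw [e]; exact not_mem_dom_boxMinus_of_mem hd

/-- ★★★★ **THIN BOX, THE CELL BELOW THE HOLE: `VF ≡ 0`.** Hole one row above the bottom wall (`h.2 = 1`) and the cell
`(h.1, 0)` below it removed ⇒ no wound walk at all (the under route was empty already; now the over route is too).
[cite: GlazmanManolescu2019, Lemma 2.1 (statement, "in the form given in [Gl]")] [cite: Glazman2015WeightedSAW, Lemma 3.1 (proof, pp. 6–7)] -/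
theorem thinBox_holeS_vertexFunctional_eq_zero (hW : 1 ≤ h.1) (hE : h.1 + 2 ≤ m) (hS : h.2 = 1) (hN : 2 ≤ n) {θ : ℝ}
    (hθ : θ ∈ Set.Icc (π / 3) (2 * π / 3)) :
    vertexFunctional (printedWeights θ) tFiveEighths (ybCoeff θ) (boxMinus m n [h, (h.1, 0)]) (Face.side (h.1 + 1, h.2) .W)
      (farW (h.1 + 1, h.2)) = 0 := by
  refine lawL_box_holeColumn_door_eq_zero hW hE (by omega) (by omega) (by simp) ?_ (fun y hy1 hy2 => by omega)
    (Or.inl ?_) hθ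
  · rw [List.mem_cons, List.mem_singleton, not_or]
    exact ⟨fun e => by have := (Prod.ext_iff.1 e).1; simp only at this; omega,
      fun e => by have := (Prod.ext_iff.1 e).1; simp only at this; omega⟩
  · have e : ((h.1, h.2 - 1) : Face) = (h.1, 0) := Prod.ext rfl (by simp only; omega)
    rw [e]; simp

/-- ★★★★ **THIN BOX, THE CELL BELOW THE ROOT PLAQUETTE: `VF ≡ 0`** (`h.2 = 1`, cell `(h.1 + 1, 0)` removed).
[cite: GlazmanManolescu2019, Lemma 2.1 (statement, "in the form given in [Gl]")] [cite: Glazman2015WeightedSAW, Lemma 3.1 (proof, pp. 6–7)] -/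
theorem thinBox_rootS_vertexFunctional_eq_zero (hW : 1 ≤ h.1) (hE : h.1 + 2 ≤ m) (hS : h.2 = 1) (hN : 2 ≤ n) {θ : ℝ}
    (hθ : θ ∈ Set.Icc (π / 3) (2 * π / 3)) :
    vertexFunctional (printedWeights θ) tFiveEighths (ybCoeff θ) (boxMinus m n [h, (h.1 + 1, 0)])
      (Face.side (h.1 + 1, h.2) .W) (farW (h.1 + 1, h.2)) = 0 := by
  refine lawL_box_holeColumn_door_eq_zero hW hE (by omega) (by omega) (by simp) ?_ (fun y hy1 hy2 => by omega)
    (Or.inr ?_) hθ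
  · rw [List.mem_cons, List.mem_singleton, not_or]
    exact ⟨fun e => by have := (Prod.ext_iff.1 e).1; simp only at this; omega,
      fun e => by have := (Prod.ext_iff.1 e).1; simp only at this; omega⟩
  · have e : ((h.1 + 1, h.2 - 1) : Face) = (h.1 + 1, 0) := Prod.ext rfl (by simp only; omega)
    rw [e]; simp

end BoxDoors

/-! ## §3 Thin boxes: the far-cell defect never vanishes when over witnesses of both kinds survive -/

section ThinWitnesses

variable {Dl : List Face} {w : Face}

/-- ★★★★ **THIN SIDE WITH ABSTRACT OVER WITNESSES ⇒ `Im VF(θ) > 0` ON THE WHOLE RANGE.** The version of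
`im_vertexFunctional_printed_pos_of_thinS` with the two over witnesses (a `w₂`-free and a `w₁`-free wound over-walk, at
every angle) given abstractly instead of through the blocks `overBlockW/E`: hole, `K_S2` and the cell below `farSW`
absent, no western door below the kill row ⇒ `M_S ≡ 0`, and the witnesses give `M_N(θ) > 0`.
[cite: GlazmanManolescu2019, Lemma 2.1 (statement, "in the form given in [Gl]"), §1 eq. (1)]
[cite: Glazman2015WeightedSAW, Lemma 3.1 (proof, pp. 6–7)] [cite: CourantRobbins1958, Ch. V Appendix §2 (the even–odd rule)] -/
theorem im_vertexFunctional_printed_pos_of_thinS_of_witnesses {θ : ℝ} (hθ : θ ∈ Set.Icc (π / 3) (2 * π / 3))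
    (hf : farW w ∈ Dl) (hh : holeFaceW w ∉ dom Dl) (hKS : killSW w ∉ dom Dl) (hT : ((w.1 - 2, w.2 - 2) : Face) ∉ dom Dl)
    (hcolS : ∀ y : ℤ, y ≤ w.2 - 3 → (w.1 - 3, y) ∉ dom Dl ∨ (w.1 - 2, y) ∉ dom Dl)
    (hr : RootedFace (dom Dl) (w.side .W) (farW w))
    (hO2 : ∀ θ' : ℝ, ∃ (ω : ΩG (dom Dl) (w.side .W) (farW w)) (h : ω.IsB2a), ω.2.firstSideG = .N ∧
      ω.WE (fun _ => θ') ≠ excursionWinding θ' ω.2.firstSideG (ω.z1 hr h) ω.1 ∧ ω.2.W2FreeOff (farW w))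
    (hO1 : ∀ θ' : ℝ, ∃ (ω : ΩG (dom Dl) (w.side .W) (farW w)) (h : ω.IsB2a), ω.2.firstSideG = .N ∧
      ω.WE (fun _ => θ') ≠ excursionWinding θ' ω.2.firstSideG (ω.z1 hr h) ω.1 ∧ ω.2.W1FreeOff (farW w)) :
    0 < (vertexFunctional (printedWeights θ) tFiveEighths (ybCoeff θ) Dl (w.side .W) (farW w)).im := by
  rcases eq_or_lt_of_le hθ.1 with e1 | h1
  · rw [← e1]
    exact im_vertexFunctional_printed_farCellW_pi_div_three_pos_of_under_killed Dl w hf hh hr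
      (ΩG.under_killed_both_of_thinS hh hKS hcolS hT hr _).1 (hO2 _)
  rcases eq_or_lt_of_le hθ.2 with e2 | h2
  · rw [e2]
    exact im_vertexFunctional_printed_farCellW_two_pi_div_three_pos_of_under_killed Dl w hf hh hr
      (ΩG.under_killed_both_of_thinS hh hKS hcolS hT hr _).2 (hO1 _)
  have hθo : θ ∈ Set.Ioo (π / 3) (2 * π / 3) := ⟨h1, h2⟩
  rw [vertexFunctional_printed_farCellW_im_eq hθ Dl w hf hh hr, ΩG.sum_routeMassW_S_eq_zero_of_thinS hh hKS hcolS hT hr θ,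
    sub_zero]
  obtain ⟨ω, h, hN, hW, -⟩ := hO2 θ
  exact mul_pos (weightV_pos_of_mem_Ioo ⟨by linarith [hθo.1, Real.pi_pos], by linarith [hθo.2, Real.pi_pos]⟩)
    (ΩG.sum_routeMassW_pos_of_wound hr .N hθo ⟨ω, h, hN, hW⟩)

/-- ★★★★ Hence **no zero on `[π/3, 2π/3]`**. [cite: GlazmanManolescu2019, Lemma 2.1 (statement, "in the form given in [Gl]")]
[cite: Glazman2015WeightedSAW, Lemma 3.1 (proof, pp. 6–7)] -/
theorem vertexFunctional_printed_ne_zero_of_thinS_of_witnesses {θ : ℝ} (hθ : θ ∈ Set.Icc (π / 3) (2 * π / 3))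
    (hf : farW w ∈ Dl) (hh : holeFaceW w ∉ dom Dl) (hKS : killSW w ∉ dom Dl) (hT : ((w.1 - 2, w.2 - 2) : Face) ∉ dom Dl)
    (hcolS : ∀ y : ℤ, y ≤ w.2 - 3 → (w.1 - 3, y) ∉ dom Dl ∨ (w.1 - 2, y) ∉ dom Dl)
    (hr : RootedFace (dom Dl) (w.side .W) (farW w))
    (hO2 : ∀ θ' : ℝ, ∃ (ω : ΩG (dom Dl) (w.side .W) (farW w)) (h : ω.IsB2a), ω.2.firstSideG = .N ∧
      ω.WE (fun _ => θ') ≠ excursionWinding θ' ω.2.firstSideG (ω.z1 hr h) ω.1 ∧ ω.2.W2FreeOff (farW w))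
    (hO1 : ∀ θ' : ℝ, ∃ (ω : ΩG (dom Dl) (w.side .W) (farW w)) (h : ω.IsB2a), ω.2.firstSideG = .N ∧
      ω.WE (fun _ => θ') ≠ excursionWinding θ' ω.2.firstSideG (ω.z1 hr h) ω.1 ∧ ω.2.W1FreeOff (farW w)) :
    vertexFunctional (printedWeights θ) tFiveEighths (ybCoeff θ) Dl (w.side .W) (farW w) ≠ 0 := by
  intro e
  have hpos := im_vertexFunctional_printed_pos_of_thinS_of_witnesses hθ hf hh hKS hT hcolS hr hO2 hO1
  rw [e, Complex.zero_im] at hpos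
  exact lt_irrefl _ hpos

end ThinWitnesses


/-! ## §4 Thin-side zero tools: both routes empty; the over route killed at one angle -/

section ThinZeroTools

variable {Dl : List Face} {w : Face}

/-- **Thin side + over route EMPTY ⇒ `VF ≡ 0`**: with the under route empty (hole, `K_S2`, the cell below `farSW` absent, no
western door below) and NO wound over-walk either, both route masses vanish.
[cite: GlazmanManolescu2019, Lemma 2.1 (statement, "in the form given in [Gl]")] [cite: Glazman2015WeightedSAW, Lemma 3.1 (proof, pp. 6–7)] -/
theorem vertexFunctional_printed_eq_zero_of_thinS_of_over_empty {θ : ℝ} (hθ : θ ∈ Set.Icc (π / 3) (2 * π / 3))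
    (hf : farW w ∈ Dl) (hh : holeFaceW w ∉ dom Dl) (hKS : killSW w ∉ dom Dl) (hT : ((w.1 - 2, w.2 - 2) : Face) ∉ dom Dl)
    (hcolS : ∀ y : ℤ, y ≤ w.2 - 3 → (w.1 - 3, y) ∉ dom Dl ∨ (w.1 - 2, y) ∉ dom Dl)
    (hr : RootedFace (dom Dl) (w.side .W) (farW w))
    (hN : ∀ (ω : ΩG (dom Dl) (w.side .W) (farW w)) (h : ω.IsB2a), ω.2.firstSideG = .N →
      ω.WE (fun _ => θ) = excursionWinding θ ω.2.firstSideG (ω.z1 hr h) ω.1) :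
    vertexFunctional (printedWeights θ) tFiveEighths (ybCoeff θ) Dl (w.side .W) (farW w) = 0 := by
  classical
  have hSum : ∑ ω ∈ ΩG.setB2a (dom Dl) (w.side .W) (farW w), ΩG.routeMassW θ hr .N ω = 0 := by
    refine Finset.sum_eq_zero fun ω _ => ?_
    unfold ΩG.routeMassW
    split_ifs with h1 h2
    · exact absurd (hN ω h1 h2.1) h2.2
    · rfl
    · rfl
  rw [vertexFunctional_printed_farCellW_eq hθ Dl w hf hh hr, ΩG.sum_routeMassW_S_eq_zero_of_thinS hh hKS hcolS hT hr θ, hSum]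
  simp

/-- **Thin side + over route `w₁`-killed ⇒ `VF(2π/3) = 0`** (both route masses vanish at the dual angle).
[cite: GlazmanManolescu2019, §1 (remark after eq. (1)), Lemma 2.1] [cite: Glazman2015WeightedSAW, Lemma 3.1 (proof, pp. 6–7)] -/
theorem vertexFunctional_printed_two_pi_div_three_eq_zero_of_thinS_of_over_w1_killed
    (hf : farW w ∈ Dl) (hh : holeFaceW w ∉ dom Dl) (hKS : killSW w ∉ dom Dl) (hT : ((w.1 - 2, w.2 - 2) : Face) ∉ dom Dl)
    (hcolS : ∀ y : ℤ, y ≤ w.2 - 3 → (w.1 - 3, y) ∉ dom Dl ∨ (w.1 - 2, y) ∉ dom Dl)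
    (hr : RootedFace (dom Dl) (w.side .W) (farW w))
    (hK : ∀ (ω : ΩG (dom Dl) (w.side .W) (farW w)) (h : ω.IsB2a), ω.2.firstSideG = .N →
      ω.WE (fun _ => 2 * π / 3) ≠ excursionWinding (2 * π / 3) ω.2.firstSideG (ω.z1 hr h) ω.1 → ¬ω.2.W1FreeOff (farW w)) :
    vertexFunctional (printedWeights (2 * π / 3)) tFiveEighths (ybCoeff (2 * π / 3)) Dl (w.side .W) (farW w) = 0 := by
  have hθ : (2 * π / 3 : ℝ) ∈ Set.Icc (π / 3) (2 * π / 3) := ⟨by linarith [Real.pi_pos], le_rfl⟩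
  rw [vertexFunctional_printed_farCellW_eq hθ Dl w hf hh hr, ΩG.sum_routeMassW_S_eq_zero_of_thinS hh hKS hcolS hT hr _,
    ΩG.sum_routeMassW_two_pi_div_three_eq_zero_of_killed hr .N hK]
  simp

/-- **Thin side + over route `w₂`-killed ⇒ `VF(π/3) = 0`.** [cite: GlazmanManolescu2019, §1 (the paragraph of Fig. 2), Lemma 2.1]
[cite: Glazman2015WeightedSAW, Lemma 3.1 (proof, pp. 6–7)] -/
theorem vertexFunctional_printed_pi_div_three_eq_zero_of_thinS_of_over_w2_killed
    (hf : farW w ∈ Dl) (hh : holeFaceW w ∉ dom Dl) (hKS : killSW w ∉ dom Dl) (hT : ((w.1 - 2, w.2 - 2) : Face) ∉ dom Dl)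
    (hcolS : ∀ y : ℤ, y ≤ w.2 - 3 → (w.1 - 3, y) ∉ dom Dl ∨ (w.1 - 2, y) ∉ dom Dl)
    (hr : RootedFace (dom Dl) (w.side .W) (farW w))
    (hK : ∀ (ω : ΩG (dom Dl) (w.side .W) (farW w)) (h : ω.IsB2a), ω.2.firstSideG = .N →
      ω.WE (fun _ => π / 3) ≠ excursionWinding (π / 3) ω.2.firstSideG (ω.z1 hr h) ω.1 → ¬ω.2.W2FreeOff (farW w)) :
    vertexFunctional (printedWeights (π / 3)) tFiveEighths (ybCoeff (π / 3)) Dl (w.side .W) (farW w) = 0 := by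
  have hθ : (π / 3 : ℝ) ∈ Set.Icc (π / 3) (2 * π / 3) := ⟨le_rfl, by linarith [Real.pi_pos]⟩
  rw [vertexFunctional_printed_farCellW_eq hθ Dl w hf hh hr, ΩG.sum_routeMassW_S_eq_zero_of_thinS hh hKS hcolS hT hr _,
    ΩG.sum_routeMassW_pi_div_three_eq_zero_of_killed hr .N hK]
  simp

/-- **Thin side + ONE `w₂`-free wound over-walk at every angle ⇒ `Im VF(θ) > 0` for `θ ∈ [π/3, 2π/3)`** (the dual endpoint
excluded: there a `w₁`-free witness would be needed). [cite: GlazmanManolescu2019, Lemma 2.1, §1 eq. (1) and Fig. 2]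
[cite: Glazman2015WeightedSAW, Lemma 3.1 (proof, pp. 6–7)] -/
theorem im_vertexFunctional_printed_pos_of_thinS_of_w2free {θ : ℝ} (hθ : θ ∈ Set.Ico (π / 3) (2 * π / 3))
    (hf : farW w ∈ Dl) (hh : holeFaceW w ∉ dom Dl) (hKS : killSW w ∉ dom Dl) (hT : ((w.1 - 2, w.2 - 2) : Face) ∉ dom Dl)
    (hcolS : ∀ y : ℤ, y ≤ w.2 - 3 → (w.1 - 3, y) ∉ dom Dl ∨ (w.1 - 2, y) ∉ dom Dl)
    (hr : RootedFace (dom Dl) (w.side .W) (farW w))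
    (hO2 : ∀ θ' : ℝ, ∃ (ω : ΩG (dom Dl) (w.side .W) (farW w)) (h : ω.IsB2a), ω.2.firstSideG = .N ∧
      ω.WE (fun _ => θ') ≠ excursionWinding θ' ω.2.firstSideG (ω.z1 hr h) ω.1 ∧ ω.2.W2FreeOff (farW w)) :
    0 < (vertexFunctional (printedWeights θ) tFiveEighths (ybCoeff θ) Dl (w.side .W) (farW w)).im := by
  have hθ' : θ ∈ Set.Icc (π / 3) (2 * π / 3) := ⟨hθ.1, hθ.2.le⟩
  rcases eq_or_lt_of_le hθ.1 with e1 | h1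
  · rw [← e1]
    exact im_vertexFunctional_printed_farCellW_pi_div_three_pos_of_under_killed Dl w hf hh hr
      (ΩG.under_killed_both_of_thinS hh hKS hcolS hT hr _).1 (hO2 _)
  have hθo : θ ∈ Set.Ioo (π / 3) (2 * π / 3) := ⟨h1, hθ.2⟩
  rw [vertexFunctional_printed_farCellW_im_eq hθ' Dl w hf hh hr, ΩG.sum_routeMassW_S_eq_zero_of_thinS hh hKS hcolS hT hr θ,
    sub_zero]
  obtain ⟨ω, h, hN, hW, -⟩ := hO2 θ
  exact mul_pos (weightV_pos_of_mem_Ioo ⟨by linarith [hθo.1, Real.pi_pos], by linarith [hθo.2, Real.pi_pos]⟩)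
    (ΩG.sum_routeMassW_pos_of_wound hr .N hθo ⟨ω, h, hN, hW⟩)

/-- **Thin side + ONE `w₁`-free wound over-walk at every angle ⇒ `Im VF(θ) > 0` for `θ ∈ (π/3, 2π/3]`.**
[cite: GlazmanManolescu2019, Lemma 2.1, §1 eq. (1) and the remark after it] [cite: Glazman2015WeightedSAW, Lemma 3.1 (proof, pp. 6–7)] -/
theorem im_vertexFunctional_printed_pos_of_thinS_of_w1free {θ : ℝ} (hθ : θ ∈ Set.Ioc (π / 3) (2 * π / 3))
    (hf : farW w ∈ Dl) (hh : holeFaceW w ∉ dom Dl) (hKS : killSW w ∉ dom Dl) (hT : ((w.1 - 2, w.2 - 2) : Face) ∉ dom Dl)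
    (hcolS : ∀ y : ℤ, y ≤ w.2 - 3 → (w.1 - 3, y) ∉ dom Dl ∨ (w.1 - 2, y) ∉ dom Dl)
    (hr : RootedFace (dom Dl) (w.side .W) (farW w))
    (hO1 : ∀ θ' : ℝ, ∃ (ω : ΩG (dom Dl) (w.side .W) (farW w)) (h : ω.IsB2a), ω.2.firstSideG = .N ∧
      ω.WE (fun _ => θ') ≠ excursionWinding θ' ω.2.firstSideG (ω.z1 hr h) ω.1 ∧ ω.2.W1FreeOff (farW w)) :
    0 < (vertexFunctional (printedWeights θ) tFiveEighths (ybCoeff θ) Dl (w.side .W) (farW w)).im := by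
  have hθ' : θ ∈ Set.Icc (π / 3) (2 * π / 3) := ⟨hθ.1.le, hθ.2⟩
  rcases eq_or_lt_of_le hθ.2 with e2 | h2
  · rw [e2]
    exact im_vertexFunctional_printed_farCellW_two_pi_div_three_pos_of_under_killed Dl w hf hh hr
      (ΩG.under_killed_both_of_thinS hh hKS hcolS hT hr _).2 (hO1 _)
  have hθo : θ ∈ Set.Ioo (π / 3) (2 * π / 3) := ⟨hθ.1, h2⟩
  rw [vertexFunctional_printed_farCellW_im_eq hθ' Dl w hf hh hr, ΩG.sum_routeMassW_S_eq_zero_of_thinS hh hKS hcolS hT hr θ,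
    sub_zero]
  obtain ⟨ω, h, hN, hW, -⟩ := hO1 θ
  exact mul_pos (weightV_pos_of_mem_Ioo ⟨by linarith [hθo.1, Real.pi_pos], by linarith [hθo.2, Real.pi_pos]⟩)
    (ΩG.sum_routeMassW_pos_of_wound hr .N hθo ⟨ω, h, hN, hW⟩)

end ThinZeroTools

/-! ## §5 The thin box of height four: the top wall two rows above the hole -/

section HeightFour

variable {m n : ℕ} {h : Face}

/-- The thin-side hypotheses of a box with the hole one row above the bottom wall, any further removals `S ∋ h` missing the
far cell: far cell present, hole absent, `K_S2` and the cell below `farSW` outside the box, nothing below row `0`.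
[cite: GlazmanManolescu2019, §2.1 (finite domains of faces)] -/
theorem thinBox_hyps {S : List Face} (hW : 2 ≤ h.1) (hE : h.1 + 2 ≤ m) (hS : h.2 = 1) (hN : 2 ≤ n) (hh : h ∈ S)
    (hfS : ((h.1 - 1, h.2) : Face) ∉ S) :
    farW ((h.1 + 1, h.2) : Face) ∈ boxMinus m n S ∧ holeFaceW ((h.1 + 1, h.2) : Face) ∉ dom (boxMinus m n S) ∧
      killSW ((h.1 + 1, h.2) : Face) ∉ dom (boxMinus m n S) ∧
      ((((h.1 + 1, h.2) : Face).1 - 2, ((h.1 + 1, h.2) : Face).2 - 2) : Face) ∉ dom (boxMinus m n S) ∧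
      (∀ y : ℤ, y ≤ ((h.1 + 1, h.2) : Face).2 - 3 →
        ((((h.1 + 1, h.2) : Face).1 - 3, y) : Face) ∉ dom (boxMinus m n S) ∨
          ((((h.1 + 1, h.2) : Face).1 - 2, y) : Face) ∉ dom (boxMinus m n S)) := by
  refine ⟨farW_hroot_mem_boxMinus_of_not_mem (by omega) (by omega) (by omega) (by omega) hfS, ?_, ?_, ?_, fun y hy => ?_⟩
  · rw [holeFaceW_hroot]; exact not_mem_dom_boxMinus_of_mem hh
  · intro hm; have hb := (mem_dom_boxMinus.1 hm).1; simp only [killSW] at hb; omega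
  · intro hm; have hb := (mem_dom_boxMinus.1 hm).1; simp only at hb; omega
  · left; intro hm; have hb := (mem_dom_boxMinus.1 hm).1; simp only at hb hy; omega


/-- The two over blocks (rows `0 … 3` of the box) sit in the height-`≥ 4` thin box minus any cell off their footprint —
here: minus a cell of the top-row corners' columns `h.1 ∓ 2` in row `3` other than the block's own cells.
[cite: GlazmanManolescu2019, §2.1 (finite domains of faces), §4.2 (translation invariance)] -/
theorem overBlockW_hroot_subset_thinBox_killNW (hW : 2 ≤ h.1) (hE : h.1 + 3 ≤ m) (hS : h.2 = 1) (hN : h.2 + 3 ≤ n) :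
    ∀ c ∈ overBlockW (h.1 + 1, h.2), c ∈ boxMinus m n [h, (h.1 - 2, h.2 + 2)] := by
  have bW : ∀ c ∈ overBlockW42, 1 ≤ c.1 ∧ c.1 ≤ 5 ∧ 1 ≤ c.2 ∧ c.2 ≤ 4 ∧ c ≠ (3, 2) ∧ c ≠ (1, 4) := by decide
  intro c hc
  simp only [overBlockW, List.mem_map] at hc
  obtain ⟨a, ha, rfl⟩ := hc
  obtain ⟨b1, b2, b3, b4, b5, b6⟩ := bW a ha
  obtain ⟨x, y⟩ := a
  simp only [ne_eq, Prod.mk.injEq, not_and] at b1 b2 b3 b4 b5 b6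
  rw [shiftBy_refShift_mk, mem_boxMinus]
  simp only [List.mem_cons, List.not_mem_nil, or_false, not_or]
  refine ⟨⟨by omega, by omega, by omega, by omega⟩, fun e => ?_, fun e => ?_⟩
  · have e' := Prod.ext_iff.1 e; simp only at e'; omega
  · have e' := Prod.ext_iff.1 e; simp only at e'; omega

/-- The `w₁`-free over block sits in the thin box minus `K_N2 = (h.1 + 2, h.2 + 2)`.
[cite: GlazmanManolescu2019, §2.1 (finite domains of faces), §4.2 (translation invariance)] -/
theorem overBlockE_hroot_subset_thinBox_killNE (hW : 2 ≤ h.1) (hE : h.1 + 3 ≤ m) (hS : h.2 = 1) (hN : h.2 + 3 ≤ n) :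
    ∀ c ∈ overBlockE (h.1 + 1, h.2), c ∈ boxMinus m n [h, (h.1 + 2, h.2 + 2)] := by
  have bE : ∀ c ∈ overBlockE42, 1 ≤ c.1 ∧ c.1 ≤ 5 ∧ 1 ≤ c.2 ∧ c.2 ≤ 4 ∧ c ≠ (3, 2) ∧ c ≠ (5, 4) := by decide
  intro c hc
  simp only [overBlockE, List.mem_map] at hc
  obtain ⟨a, ha, rfl⟩ := hc
  obtain ⟨b1, b2, b3, b4, b5, b6⟩ := bE a ha
  obtain ⟨x, y⟩ := a
  simp only [ne_eq, Prod.mk.injEq, not_and] at b1 b2 b3 b4 b5 b6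
  rw [shiftBy_refShift_mk, mem_boxMinus]
  simp only [List.mem_cons, List.not_mem_nil, or_false, not_or]
  refine ⟨⟨by omega, by omega, by omega, by omega⟩, fun e => ?_, fun e => ?_⟩
  · have e' := Prod.ext_iff.1 e; simp only at e'; omega
  · have e' := Prod.ext_iff.1 e; simp only at e'; omega

/-- ★★★★★ **THE THIN BOX OF HEIGHT FOUR, `K_N1` REMOVED: AN ISOLATED ZERO AT THE DUAL ANGLE.** In the `m × 4` box with the
hole `h = (h.1, 1)` (`2 ≤ h.1 ≤ m − 3`) remove the corner cell `K_N1 = (h.1 − 2, 3)`, which lies on the top wall: the over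
route is `w₁`-killed (north-western corridor), the under route is empty (thin side) ⇒ `VF(2π/3) = 0` EXACTLY, while
`Im VF(θ) > 0` — so `VF(θ) ≠ 0` — for every `θ ∈ [π/3, 2π/3)` (the `w₂`-free over block survives). A vanishing at one
endpoint of the hexagonal range and nowhere else on it. [cite: GlazmanManolescu2019, §1 (remark after eq. (1)), §2.1, Lemma 2.1]
[cite: Glazman2015WeightedSAW, Lemma 3.1 (proof, pp. 6–7)] [cite: CourantRobbins1958, Ch. V Appendix §2 (the even–odd rule)] -/
theorem thinBox4_killNW_vertexFunctional_two_pi_div_three_eq_zero (hW : 2 ≤ h.1) (hE : h.1 + 3 ≤ m) (hS : h.2 = 1)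
    (hN : h.2 + 3 = n) :
    vertexFunctional (printedWeights (2 * π / 3)) tFiveEighths (ybCoeff (2 * π / 3))
      (boxMinus m n [h, killNW (h.1 + 1, h.2)]) (Face.side (h.1 + 1, h.2) .W) (farW (h.1 + 1, h.2)) = 0 := by
  obtain ⟨hf, hh, hKS, hT, hcolS⟩ := thinBox_hyps (m := m) (n := n) (S := [h, killNW (h.1 + 1, h.2)]) hW (by omega) hS
    (by omega) (by simp) (by
      rw [List.mem_cons, List.mem_singleton, not_or]
      exact ⟨fun e => by have := (Prod.ext_iff.1 e).1; simp only at this; omega,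
        fun e => by have := (Prod.ext_iff.1 e).2; simp only [killNW] at this; omega⟩)
  have hr := rootedFace_hroot_boxMinus_of_mem hf (by simp)
  refine vertexFunctional_printed_two_pi_div_three_eq_zero_of_thinS_of_over_w1_killed hf hh hKS hT hcolS hr ?_
  refine ΩG.over_killed_of_killNW_corridor hh (not_mem_dom_boxMinus_of_mem (by simp))
    (isCorridorNW_boxMinus (Or.inr hN) (by simp)) (fun y hy => ?_) hr _
  simp only at hy ⊢
  by_cases hD : ((h.1 + 1 - 3, y) : Face) ∈ dom (boxMinus m n [h, killNW (h.1 + 1, h.2)])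
  · right; right; simp only [Set.mem_setOf_eq]; exact ⟨hD, by omega, by omega⟩
  · exact Or.inl hD

/-- … and `VF(θ) ≠ 0` (indeed `Im VF(θ) > 0`) for every `θ ∈ [π/3, 2π/3)`.
[cite: GlazmanManolescu2019, §1 (Fig. 2), §2.1, Lemma 2.1] [cite: Glazman2015WeightedSAW, Lemma 3.1 (proof, pp. 6–7)] -/
theorem thinBox4_killNW_im_pos_of_lt (hW : 2 ≤ h.1) (hE : h.1 + 3 ≤ m) (hS : h.2 = 1) (hN : h.2 + 3 = n) {θ : ℝ}
    (hθ : θ ∈ Set.Ico (π / 3) (2 * π / 3)) :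
    0 < (vertexFunctional (printedWeights θ) tFiveEighths (ybCoeff θ) (boxMinus m n [h, killNW (h.1 + 1, h.2)])
      (Face.side (h.1 + 1, h.2) .W) (farW (h.1 + 1, h.2))).im := by
  obtain ⟨hf, hh, hKS, hT, hcolS⟩ := thinBox_hyps (m := m) (n := n) (S := [h, killNW (h.1 + 1, h.2)]) hW (by omega) hS
    (by omega) (by simp) (by
      rw [List.mem_cons, List.mem_singleton, not_or]
      exact ⟨fun e => by have := (Prod.ext_iff.1 e).1; simp only at this; omega,
        fun e => by have := (Prod.ext_iff.1 e).2; simp only [killNW] at this; omega⟩)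
  have hr := rootedFace_hroot_boxMinus_of_mem hf (by simp)
  have e : killNW ((h.1 + 1, h.2) : Face) = (h.1 - 2, h.2 + 2) :=
    Prod.ext (by simp only [killNW]; omega) (by simp only [killNW])
  have hB : ∀ c ∈ overBlockW (h.1 + 1, h.2), c ∈ boxMinus m n [h, killNW (h.1 + 1, h.2)] := by
    rw [e]; exact overBlockW_hroot_subset_thinBox_killNW hW hE hS hN.le
  exact im_vertexFunctional_printed_pos_of_thinS_of_w2free hθ hf hh hKS hT hcolS hr
    fun θ' => exists_over_w2free_of_overBlockW hB hr θ'

/-- ★★★★★ **THE THIN BOX OF HEIGHT FOUR, `K_N2` REMOVED: AN ISOLATED ZERO AT THE HONEYCOMB ANGLE** — `K_N2 = (h.1 + 2, 3)` on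
the top wall: the over route is `w₂`-killed, the under route empty ⇒ `VF(π/3) = 0` exactly.
[cite: GlazmanManolescu2019, §1 (the paragraph of Fig. 2), §2.1, Lemma 2.1] [cite: Glazman2015WeightedSAW, Lemma 3.1 (proof, pp. 6–7)]
[cite: CourantRobbins1958, Ch. V Appendix §2 (the even–odd rule)] -/
theorem thinBox4_killNE_vertexFunctional_pi_div_three_eq_zero (hW : 2 ≤ h.1) (hE : h.1 + 3 ≤ m) (hS : h.2 = 1)
    (hN : h.2 + 3 = n) :
    vertexFunctional (printedWeights (π / 3)) tFiveEighths (ybCoeff (π / 3))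
      (boxMinus m n [h, killNE (h.1 + 1, h.2)]) (Face.side (h.1 + 1, h.2) .W) (farW (h.1 + 1, h.2)) = 0 := by
  obtain ⟨hf, hh, hKS, hT, hcolS⟩ := thinBox_hyps (m := m) (n := n) (S := [h, killNE (h.1 + 1, h.2)]) hW (by omega) hS
    (by omega) (by simp) (by
      rw [List.mem_cons, List.mem_singleton, not_or]
      exact ⟨fun e => by have := (Prod.ext_iff.1 e).1; simp only at this; omega,
        fun e => by have := (Prod.ext_iff.1 e).2; simp only [killNE] at this; omega⟩)
  have hr := rootedFace_hroot_boxMinus_of_mem hf (by simp)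
  refine vertexFunctional_printed_pi_div_three_eq_zero_of_thinS_of_over_w2_killed hf hh hKS hT hcolS hr ?_
  refine ΩG.over_w2_killed_of_killNE_corridor hh (not_mem_dom_boxMinus_of_mem (by simp))
    (isCorridorN_boxMinus (Or.inr hN) (by simp)) (fun y hy => ?_) hr _
  simp only at hy ⊢
  by_cases hD : ((h.1 + 1 + 1, y) : Face) ∈ dom (boxMinus m n [h, killNE (h.1 + 1, h.2)])
  · right; right; simp only [Set.mem_setOf_eq]; exact ⟨hD, by omega, by omega⟩
  · exact Or.inr (Or.inl hD)

/-- … and `Im VF(θ) > 0` for every `θ ∈ (π/3, 2π/3]` (the `w₁`-free over block survives).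
[cite: GlazmanManolescu2019, §1 (remark after eq. (1)), §2.1, Lemma 2.1] [cite: Glazman2015WeightedSAW, Lemma 3.1 (proof, pp. 6–7)] -/
theorem thinBox4_killNE_im_pos_of_gt (hW : 2 ≤ h.1) (hE : h.1 + 3 ≤ m) (hS : h.2 = 1) (hN : h.2 + 3 = n) {θ : ℝ}
    (hθ : θ ∈ Set.Ioc (π / 3) (2 * π / 3)) :
    0 < (vertexFunctional (printedWeights θ) tFiveEighths (ybCoeff θ) (boxMinus m n [h, killNE (h.1 + 1, h.2)])
      (Face.side (h.1 + 1, h.2) .W) (farW (h.1 + 1, h.2))).im := by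
  obtain ⟨hf, hh, hKS, hT, hcolS⟩ := thinBox_hyps (m := m) (n := n) (S := [h, killNE (h.1 + 1, h.2)]) hW (by omega) hS
    (by omega) (by simp) (by
      rw [List.mem_cons, List.mem_singleton, not_or]
      exact ⟨fun e => by have := (Prod.ext_iff.1 e).1; simp only at this; omega,
        fun e => by have := (Prod.ext_iff.1 e).2; simp only [killNE] at this; omega⟩)
  have hr := rootedFace_hroot_boxMinus_of_mem hf (by simp)
  have e : killNE ((h.1 + 1, h.2) : Face) = (h.1 + 2, h.2 + 2) :=
    Prod.ext (by simp only [killNE]; omega) (by simp only [killNE])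
  have hB : ∀ c ∈ overBlockE (h.1 + 1, h.2), c ∈ boxMinus m n [h, killNE (h.1 + 1, h.2)] := by
    rw [e]; exact overBlockE_hroot_subset_thinBox_killNE hW hE hS hN.le
  exact im_vertexFunctional_printed_pos_of_thinS_of_w1free hθ hf hh hKS hT hcolS hr
    fun θ' => exists_over_w1free_of_overBlockE hB hr θ'

/-- ★★★★ **THE THIN BOX OF HEIGHT FOUR, THE CELL ABOVE `farNW` REMOVED (`(h.1 − 1, 3)`) ⇒ `VF ≡ 0`**: the over route is
emptied by the shut row at the top wall, the under route by the thin side — no wound walk at all.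
[cite: GlazmanManolescu2019, Lemma 2.1 (statement, "in the form given in [Gl]"), §2.1] [cite: Glazman2015WeightedSAW, Lemma 3.1 (proof, pp. 6–7)] -/
theorem thinBox4_farNWN_vertexFunctional_eq_zero (hW : 2 ≤ h.1) (hE : h.1 + 3 ≤ m) (hS : h.2 = 1) (hN : h.2 + 3 = n)
    {θ : ℝ} (hθ : θ ∈ Set.Icc (π / 3) (2 * π / 3)) :
    vertexFunctional (printedWeights θ) tFiveEighths (ybCoeff θ) (boxMinus m n [h, (h.1 - 1, h.2 + 2)])
      (Face.side (h.1 + 1, h.2) .W) (farW (h.1 + 1, h.2)) = 0 := by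
  obtain ⟨hf, hh, hKS, hT, hcolS⟩ := thinBox_hyps (m := m) (n := n) (S := [h, (h.1 - 1, h.2 + 2)]) hW (by omega) hS
    (by omega) (by simp) (by
      rw [List.mem_cons, List.mem_singleton, not_or]
      exact ⟨fun e => by have := (Prod.ext_iff.1 e).1; simp only at this; omega,
        fun e => by have := (Prod.ext_iff.1 e).2; simp only at this; omega⟩)
  have hr := rootedFace_hroot_boxMinus_of_mem hf (by simp)
  refine vertexFunctional_printed_eq_zero_of_thinS_of_over_empty hθ hf hh hKS hT hcolS hr fun ω hb hNd => ?_
  refine ΩG.WE_eq_excursionWinding_of_over_farNWN hh ?_ (fun y hy => ?_) ω hr hb hNd θ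
  · have e : ((((h.1 + 1, h.2) : Face).1 - 2, ((h.1 + 1, h.2) : Face).2 + 2) : Face) = (h.1 - 1, h.2 + 2) :=
      Prod.ext (by simp only; omega) rfl
    rw [e]; exact not_mem_dom_boxMinus_of_mem (by simp)
  · left; intro hm; have hb' := (mem_dom_boxMinus.1 hm).1; simp only at hb' hy; omega

/-- ★★★★ **THE THIN BOX OF HEIGHT FOUR, THE CELL ABOVE THE HOLE REMOVED (`(h.1, 3)`) ⇒ `VF ≡ 0`** (over route emptied by
the shut hole column above, under route by the thin side). [cite: GlazmanManolescu2019, Lemma 2.1 (statement, "in the form given in [Gl]"), §2.1]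
[cite: Glazman2015WeightedSAW, Lemma 3.1 (proof, pp. 6–7)] -/
theorem thinBox4_holeNN_vertexFunctional_eq_zero (hW : 2 ≤ h.1) (hE : h.1 + 3 ≤ m) (hS : h.2 = 1) (hN : h.2 + 3 = n)
    {θ : ℝ} (hθ : θ ∈ Set.Icc (π / 3) (2 * π / 3)) :
    vertexFunctional (printedWeights θ) tFiveEighths (ybCoeff θ) (boxMinus m n [h, (h.1, h.2 + 2)])
      (Face.side (h.1 + 1, h.2) .W) (farW (h.1 + 1, h.2)) = 0 := by
  obtain ⟨hf, hh, hKS, hT, hcolS⟩ := thinBox_hyps (m := m) (n := n) (S := [h, (h.1, h.2 + 2)]) hW (by omega) hS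
    (by omega) (by simp) (by
      rw [List.mem_cons, List.mem_singleton, not_or]
      exact ⟨fun e => by have := (Prod.ext_iff.1 e).1; simp only at this; omega,
        fun e => by have := (Prod.ext_iff.1 e).1; simp only at this; omega⟩)
  have hr := rootedFace_hroot_boxMinus_of_mem hf (by simp)
  refine vertexFunctional_printed_eq_zero_of_thinS_of_over_empty hθ hf hh hKS hT hcolS hr fun ω hb hNd => ?_
  refine ΩG.WE_eq_excursionWinding_of_over_holeColumnN hh (fun y hy hm => ?_) ω hr hb hNd θ
  have hb' := mem_dom_boxMinus.1 hm
  simp only [List.mem_cons, List.not_mem_nil, or_false, not_or, Prod.mk.injEq] at hb' hy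
  omega

/-- ★★★★ **THE THIN BOX OF HEIGHT FOUR, THE CELL ABOVE `rootN` REMOVED (`(h.1 + 1, 3)`) ⇒ `VF(π/3) = 0`** (over route
`w₂`-killed by the shut row at the top wall, under route empty). [cite: GlazmanManolescu2019, §1 (the paragraph of Fig. 2), §2.1, Lemma 2.1]
[cite: Glazman2015WeightedSAW, Lemma 3.1 (proof, pp. 6–7)] [cite: CourantRobbins1958, Ch. V Appendix §2 (the even–odd rule)] -/
theorem thinBox4_rootNN_vertexFunctional_pi_div_three_eq_zero (hW : 2 ≤ h.1) (hE : h.1 + 3 ≤ m) (hS : h.2 = 1)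
    (hN : h.2 + 3 = n) :
    vertexFunctional (printedWeights (π / 3)) tFiveEighths (ybCoeff (π / 3))
      (boxMinus m n [h, (h.1 + 1, h.2 + 2)]) (Face.side (h.1 + 1, h.2) .W) (farW (h.1 + 1, h.2)) = 0 := by
  obtain ⟨hf, hh, hKS, hT, hcolS⟩ := thinBox_hyps (m := m) (n := n) (S := [h, (h.1 + 1, h.2 + 2)]) hW (by omega) hS
    (by omega) (by simp) (by
      rw [List.mem_cons, List.mem_singleton, not_or]
      exact ⟨fun e => by have := (Prod.ext_iff.1 e).1; simp only at this; omega,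
        fun e => by have := (Prod.ext_iff.1 e).1; simp only at this; omega⟩)
  have hr := rootedFace_hroot_boxMinus_of_mem hf (by simp)
  have hc : ((h.1 + 1, h.2 + 2) : Face) ∉ dom (boxMinus m n [h, (h.1 + 1, h.2 + 2)]) :=
    not_mem_dom_boxMinus_of_mem (by simp)
  refine vertexFunctional_printed_pi_div_three_eq_zero_of_thinS_of_over_w2_killed hf hh hKS hT hcolS hr ?_
  refine ΩG.over_w2_killed_of_shutRowNE hh (Or.inr ?_)
    (R := {c | c ∈ dom (boxMinus m n [h, (h.1 + 1, h.2 + 2)]) ∧ h.1 + 2 ≤ c.1 ∧ h.2 + 3 ≤ c.2}) ?_ (fun y hy => ?_) hr _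
  · have e : ((((h.1 + 1, h.2) : Face).1, ((h.1 + 1, h.2) : Face).2 + 2) : Face) = (h.1 + 1, h.2 + 2) := Prod.ext (by simp only) rfl
    rw [e]; exact hc
  · intro c hc'
    simp only [Set.mem_setOf_eq] at hc'
    obtain ⟨hcD, -, hc2⟩ := hc'
    have hb' := (mem_dom_boxMinus.1 hcD).1
    omega
  · left; intro hm; have hb' := (mem_dom_boxMinus.1 hm).1; simp only at hb' hy; omega

end HeightFour

end Literature.Barriers.CriticalPhenomena.PlaquetteWalk
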